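import Summits.BirchSwinnertonDyer.Rank1Residual.Additive.SubGordTwoReducible
import Summits.BirchSwinnertonDyer.Rank1Residual.Additive.SubGordThree
import Summits.BirchSwinnertonDyer.Rank1Residual.Additive.GordRankZeroKatoComponent
import Summits.BirchSwinnertonDyer.Rank1Residual.AdditivePotMult.RankZeroChiBranchPrimeFacts
import HarnessLib

/-!
# X3♯ REDUCED TO ITS RESIDUES AT EVERY ODD PRIME — the end-state map of the Eisenstein additive
# class X3 as ONE kernel statement (cell `b2b-bsdres`, seat additive-p4, line V22 for X3; twin of
# `Additive/X4SharpUnitFreeResidue.lean`)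

HONEST FRAMING (cell `b2b-bsdres`, run/shared/lean/b2b/bsd-rank1-residual/, verbatim in every
file): the goal of the cell is to DELETE the COMBINATION-SHAPED residual classes of the
Birch–Swinnerton-Dyer formula for ALL analytic-rank `≤ 1` elliptic curves over `ℚ` — "full BSD
formula for every rank `≤ 1` curve in class `C`" assembled STRICTLY from published theorems — so
that the rank-`≤ 1` remainder becomes exactly the CONSTRUCTION-SHAPED classes, which are TYPED
(missing-input `Prop`s), NOT attempted. This is not "finishing BSD". Sub-cell additive-p4 (X3♯/X4♯
direct): research route on the CONSTRUCTION-SHAPED class X3; no claim beyond the stated classes;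
the label X3 is UNCHANGED by this file; nothing is booked. Theorems only (no definition, no named
fact minted; every published input is an explicit named-fact hypothesis of the tree).

## What this file proves

The sharpened conjecture **X3♯** (`Additive.X3Sharp`: for every `E/ℚ` of analytic rank `≤ 1` and
every odd ADDITIVE prime `p` at which `E` admits a rational `p`-isogeny, `ord_p #Ш(E) = ord_p #Ш_an(E)`)
splits along the seat's census cells as `X3Sharp ⟺ X3SharpSemistableTwist ∧ X3SharpGordHigher ∧
X3SharpTprime ∧ X3SharpW` (`x3Sharp_iff_twist_split`, `SharpenedStatements`), the first conjunct
being the (M) ∪ (G-ord, `e = 2`) rows — those whose twist `E^{(p*)}` is semistable at `p`. On that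
cell, in analytic rank `0`, the UPPER half `ord_p #Ш ≤ ord_p #Ш_an` is a theorem of the published
record at EVERY odd `p`, with NO image, NO Tamagawa and NO Manin hypothesis (reducible `E[p]`!):
seat additive-p1's `ClassX3M.missingUpperBoundAt_rankZero` ((M): Delbourgo 1998 Prop. 4 `hDel`,
modular parametrisation data `hmodD`, Wuthrich 2014 Thm. 16 on the `ω^{(p−1)/2}`-component over
`ℚ(μ_{p^∞})` `hW16`) and seat additive-p2's
`ClassX3Gord.missingUpperBoundAt_rankZero_of_wuthrichComponent` ((G-ord, `e = 2`): Wuthrich's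
component divisibility `hWu`, `hDel`, `hmodD`; the data cell `SubGordTwo` lies in the theory class
`ClassX3Gord` by `classX3Gord_of_subGordTwo` (`p ≥ 5`) / `classX3Gord_three_iff_subGord` (`p = 3`)).
This file SUMS them:

* §1 `ClassX3.missingUpperBoundAt_rankZero_of_subSemistableTwist` — X3 ∧ `p ≠ 2` ∧ `r_an = 0` ∧
  (`ord_p j < 0` ∨ (G-ord with `e = 2`)) ⟹ `MissingUpperBoundAt W p`; `…missingPPartAt_iff_lower…`;
  **`ClassX3.bsdp_rankZero_of_subSemistableTwist_of_shaAn_unit`** (`BSD(E,p)` on every such row with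
  `p ∤ #Ш_an(E)` — the cell's chain of record for X3 ∧ `r = 0` ∧ semistable twist, every odd `p`,
  four named facts + GZK + modularity, NO certificate at all).
* §2 **`x3SharpSemistableTwist_iff_lower_and_rankOne`**: X3♯(semistable twist) ⟺ LOWER (the lower
  half on its rank-`0` rows) ∧ RANK-ONE (X3♯ on its rank-`1` rows — nothing in print: no `p`-adic
  Gross–Zagier for the `ω^{(p−1)/2}`-branch, Kolyvagin needs `ρ̄` onto);
  **`x3Sharp_iff_residues`**: X3♯ ⟺ LOWER ∧ RANK-ONE ∧ X3♯(G-ord, `e ≠ 2`) ∧ X3♯(t′) ∧ X3♯(w) —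
  the end-state of class X3 as one kernel statement: what no published theorem reaches is the lower
  half on the semistable-twist rank-`0` rows, and EVERYTHING on the rank-`1`, higher-defect,
  potentially supersingular and wild rows (no `p`-adic `L`-function / main conjecture in print there:
  SHARPENED-CONJECTURES §3, REPAIR-CENSUS V10/V11).

Census (hyp SHARPENED v3.2 §3, N < 2·10⁴ ‖ 10⁴): X3♯ 2 392 ‖ 1 283 pairs = (M) 517 ‖ 298 + (G-ord)
334 ‖ 191 [`e = 2`: 301] + (t′) 412 ‖ 210 + (w) 1 129 ‖ 584; rank `0` / `1`: (M) 281/236, (G-ord,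
`e = 2`) 173/128. So the kernel covers the upper half on 454 rank-`0` pairs (BSD_p on their `p ∤ #Ш_an`
rows); the residue is the rest. X3 stays CONSTRUCTION-SHAPED; nothing booked.

References: Delbourgo 1998 [Delbourgo1998] Prop. 4; Wuthrich 2014 [Wuthrich2014] Thm. 16, §3;
Mazur–Tate–Teitelbaum 1986 [MazurTateTeitelbaum1986Invent] §I.13–14; Serre 1972 [Serre1972] §1.11;
Miller 2011 [Miller2011LMS] Def. 1.1; SHARPENED-CONJECTURES.md §3.
-/

noncomputable section

open scoped Classical

open WeierstrassCurve Literature.NumberTheory.EllipticCurves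
  Literature.NumberTheory.EllipticCurves.ModularForms
  Literature.NumberTheory.EllipticCurves.Rank1Residual
  Literature.NumberTheory.EllipticCurves.Rank1Residual.Typed

namespace Summit.BirchSwinnertonDyer.Rank1Residual.Additive

variable (W : WeierstrassCurve ℚ) [W.IsElliptic] [W.IsGloballyMinimal] (p : ℕ) [hp : Fact p.Prime]

/-! ### §1 X3 ∧ semistable twist ∧ `r_an = 0`: the upper half at every odd `p` -/

/-- **The data cell (G-ord, `e = 2`) of X3 lies in the theory class X3♯(G-ord) at every odd `p`**
(`classX3Gord_of_subGordTwo` at `p ≥ 5`, `classX3Gord_three_iff_subGord` at `p = 3`). [folklore] -/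
theorem classX3Gord_of_subGordTwo_of_odd (hp2 : p ≠ 2) (hX : ClassX3 W p) (hS : SubGordTwo W p) :
    ClassX3Gord W p := by
  by_cases hp3 : p = 3
  · subst hp3
    exact (classX3Gord_three_iff_subGord W hX).mpr hS.1
  · exact classX3Gord_of_subGordTwo W p (hp.out.five_le_of_ne_two_of_ne_three hp2 hp3) hX hS

/-- **X3 ∧ `p ≠ 2` ∧ `r_an = 0` ∧ semistable twist ((M) `ord_p j < 0` ∨ (G-ord, `e = 2`)): the UPPER
half `ord_p #Ш(E) ≤ ord_p #Ш_an(E)` at EVERY odd `p`**, from FOUR named facts — Delbourgo 1998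
Prop. 4 (`hDel`), modular parametrisation data (`hmodD`), Wuthrich 2014 Thm. 16 on the
`ω^{(p−1)/2}`-component over `ℚ(μ_{p^∞})` (`hW16`, (M) rows: additive-p1's
`ClassX3M.missingUpperBoundAt_rankZero`), Wuthrich's component divisibility for the good ordinary
twist (`hWu`, (G-ord) rows: additive-p2's `ClassX3Gord.missingUpperBoundAt_rankZero_of_wuthrichComponent`)
— + GZK + modularity. NO image, NO Tamagawa, NO Manin hypothesis.
[cite: Delbourgo1998, Prop. 4 (p. 144)] [cite: Wuthrich2014, Thm. 16 (p. 397) and §3 (p. 390)]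
[cite: Miller2011LMS, Def. 1.1] -/
theorem ClassX3.missingUpperBoundAt_rankZero_of_subSemistableTwist
    (hDel : Delbourgo1998.prop4_rankZero_pow_dvd_constantCoeff)
    (hGZK : rank_eq_analyticRank_of_analyticRank_le_one) (hmod : hasEntireLFunction_rat)
    (hmodD : nonempty_modularParametrizationData)
    (hW16 : Wuthrich2014.thm16_halfEigenCharIdeal_dvd_cyclotomicPrime)
    (hWu : Wuthrich2014.charIdeal_dvd_padicLFunctionBranch_component)
    (hp2 : p ≠ 2) (hX : ClassX3 W p) (hr : W.analyticRank = 0) (hS : SubSemistableTwist W p) :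
    MissingUpperBoundAt W p := by
  rcases hS with hM | hG
  · exact AdditivePotMult.ClassX3M.missingUpperBoundAt_rankZero hDel hGZK hmod hmodD hW16
      ⟨hX, ⟨hX.2, hM⟩, hp2⟩ hr
  · exact ClassX3Gord.missingUpperBoundAt_rankZero_of_wuthrichComponent hWu hDel hGZK hmod hmodD hp2
      (classX3Gord_of_subGordTwo_of_odd W p hp2 hX hG) hG.2 hr

/-- **On X3 ∧ `r_an = 0` ∧ semistable twist the typed X3 input is EXACTLY the lower half**, every
odd `p`. [cite: Delbourgo1998, Prop. 4 (p. 144)] [cite: Wuthrich2014, Thm. 16 (p. 397)] [cite: Miller2011LMS, Def. 1.1] -/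
theorem ClassX3.missingPPartAt_iff_lower_rankZero_of_subSemistableTwist
    (hDel : Delbourgo1998.prop4_rankZero_pow_dvd_constantCoeff)
    (hGZK : rank_eq_analyticRank_of_analyticRank_le_one) (hmod : hasEntireLFunction_rat)
    (hmodD : nonempty_modularParametrizationData)
    (hW16 : Wuthrich2014.thm16_halfEigenCharIdeal_dvd_cyclotomicPrime)
    (hWu : Wuthrich2014.charIdeal_dvd_padicLFunctionBranch_component)
    (hp2 : p ≠ 2) (hX : ClassX3 W p) (hr : W.analyticRank = 0) (hS : SubSemistableTwist W p) :
    MissingPPartAt W p ↔ MissingLowerBoundAt W p :=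
  ⟨fun h ↦ (lower_and_upper_of_missingPPartAt W p h).1, fun h ↦
    missingPPartAt_of_lower_of_upper W p h
      (ClassX3.missingUpperBoundAt_rankZero_of_subSemistableTwist W p hDel hGZK hmod hmodD hW16 hWu
        hp2 hX hr hS)⟩

/-- **THE CHAIN OF RECORD FOR X3 ∧ `r = 0` ∧ semistable twist, every odd `p`: `BSD(E,p)` when
`#Ш_an(E)` is a `p`-unit** — four named facts + GZK + modularity, NO certificate beyond
[`r_an = 0`, `p ∤ #Ш_an`, the cell bit]. [cite: Delbourgo1998, Prop. 4 (p. 144)]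
[cite: Wuthrich2014, Thm. 16 (p. 397) and §3 (p. 390)] [cite: Miller2011LMS, §1 and Def. 1.1] -/
theorem ClassX3.bsdp_rankZero_of_subSemistableTwist_of_shaAn_unit
    (hDel : Delbourgo1998.prop4_rankZero_pow_dvd_constantCoeff)
    (hGZK : rank_eq_analyticRank_of_analyticRank_le_one) (hmod : hasEntireLFunction_rat)
    (hmodD : nonempty_modularParametrizationData)
    (hW16 : Wuthrich2014.thm16_halfEigenCharIdeal_dvd_cyclotomicPrime)
    (hWu : Wuthrich2014.charIdeal_dvd_padicLFunctionBranch_component)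
    (hp2 : p ≠ 2) (hX : ClassX3 W p) (hr : W.analyticRank = 0) (hS : SubSemistableTwist W p)
    {q : ℚ} (hq : shaAn W = (q : ℂ)) (hv : padicValRat p q = 0) : BSDp W p :=
  bsdp_of_missingPPartAt W p hGZK (by rw [hr]; exact zero_le_one)
    (missingPPartAt_of_upper_of_shaAn_unit W p
      (ClassX3.missingUpperBoundAt_rankZero_of_subSemistableTwist W p hDel hGZK hmod hmodD hW16 hWu
        hp2 hX hr hS) hq hv)

/-- **`BSD(E,p)` on X3 ∧ `r_an = 0` ∧ semistable twist from the LOWER half alone**, every odd `p`.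
[cite: Delbourgo1998, Prop. 4 (p. 144)] [cite: Wuthrich2014, Thm. 16 (p. 397)] [cite: Miller2011LMS, §1 and Def. 1.1] -/
theorem ClassX3.bsdp_rankZero_of_subSemistableTwist_of_lower
    (hDel : Delbourgo1998.prop4_rankZero_pow_dvd_constantCoeff)
    (hGZK : rank_eq_analyticRank_of_analyticRank_le_one) (hmod : hasEntireLFunction_rat)
    (hmodD : nonempty_modularParametrizationData)
    (hW16 : Wuthrich2014.thm16_halfEigenCharIdeal_dvd_cyclotomicPrime)
    (hWu : Wuthrich2014.charIdeal_dvd_padicLFunctionBranch_component)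
    (hp2 : p ≠ 2) (hX : ClassX3 W p) (hr : W.analyticRank = 0) (hS : SubSemistableTwist W p)
    (hlow : MissingLowerBoundAt W p) : BSDp W p :=
  bsdp_of_missingPPartAt W p hGZK (by rw [hr]; exact zero_le_one)
    ((ClassX3.missingPPartAt_iff_lower_rankZero_of_subSemistableTwist W p hDel hGZK hmod hmodD hW16
      hWu hp2 hX hr hS).mpr hlow)

/-! ### §2 THE REDUCTION of X3♯ to its residues -/

/-- **X3♯(semistable twist) ⟺ LOWER ∧ RANK-ONE** (granted the four named facts + GZK + modularity):
the (M) ∪ (G-ord, `e = 2`) part of X3♯ is EQUIVALENT to the lower half `ord_p #Ш_an ≤ ord_p #Ш` on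
its rank-`0` rows (the Skinner–Urban / Greenberg–Vatsal direction on the `ω^{(p−1)/2}`-branch —
printed nowhere) together with X3♯ on its rank-`1` rows (no `p`-adic Gross–Zagier for that branch;
Kolyvagin's bound needs `ρ̄_{E,p}` onto). [cite: Delbourgo1998, Prop. 4 (p. 144)]
[cite: Wuthrich2014, Thm. 16 (p. 397)] [cite: Miller2011LMS, Def. 1.1] -/
theorem x3SharpSemistableTwist_iff_lower_and_rankOne
    (hDel : Delbourgo1998.prop4_rankZero_pow_dvd_constantCoeff)
    (hGZK : rank_eq_analyticRank_of_analyticRank_le_one) (hmod : hasEntireLFunction_rat)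
    (hmodD : nonempty_modularParametrizationData)
    (hW16 : Wuthrich2014.thm16_halfEigenCharIdeal_dvd_cyclotomicPrime)
    (hWu : Wuthrich2014.charIdeal_dvd_padicLFunctionBranch_component) :
    X3SharpSemistableTwist ↔
      (∀ (W : WeierstrassCurve ℚ) [W.IsElliptic] [W.IsGloballyMinimal] (p : ℕ) [Fact p.Prime],
          W.analyticRank = 0 → p ≠ 2 → ClassX3 W p → SubSemistableTwist W p →
          MissingLowerBoundAt W p) ∧
      (∀ (W : WeierstrassCurve ℚ) [W.IsElliptic] [W.IsGloballyMinimal] (p : ℕ) [Fact p.Prime],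
          W.analyticRank = 1 → p ≠ 2 → ClassX3 W p → SubSemistableTwist W p →
          MissingPPartAt W p) := by
  constructor
  · intro h
    exact ⟨fun V _ _ p _ hr hp2 hX hS ↦
        (lower_and_upper_of_missingPPartAt V p (h V p (by rw [hr]; exact zero_le_one) hp2 hX hS)).1,
      fun V _ _ p _ hr hp2 hX hS ↦ h V p (by rw [hr]) hp2 hX hS⟩
  · rintro ⟨hlow, hone⟩ V _ _ p _ hr hp2 hX hS
    rcases Nat.le_one_iff_eq_zero_or_eq_one.mp hr with h0 | h1
    · exact (ClassX3.missingPPartAt_iff_lower_rankZero_of_subSemistableTwist V p hDel hGZK hmod hmodD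
        hW16 hWu hp2 hX h0 hS).mpr (hlow V p h0 hp2 hX hS)
    · exact hone V p h1 hp2 hX hS

/-- **X3♯ ⟺ LOWER ∧ RANK-ONE ∧ X3♯(G-ord, `e ≠ 2`) ∧ X3♯(t′) ∧ X3♯(w)** — the end-state map of
class X3 as ONE kernel statement (granted the four named facts + GZK + modularity): what no
published theorem reaches is exactly the lower half on the semistable-twist rank-`0` rows, X3♯ on
the semistable-twist rank-`1` rows, and ALL of the higher-defect potentially ordinary, the
potentially supersingular and the wild cells (no `p`-adic `L`-function or main conjecture in print
there). [cite: Delbourgo1998, Prop. 4 (p. 144)] [cite: Wuthrich2014, Thm. 16 (p. 397)]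
[cite: Miller2011LMS, Def. 1.1] -/
theorem x3Sharp_iff_residues
    (hDel : Delbourgo1998.prop4_rankZero_pow_dvd_constantCoeff)
    (hGZK : rank_eq_analyticRank_of_analyticRank_le_one) (hmod : hasEntireLFunction_rat)
    (hmodD : nonempty_modularParametrizationData)
    (hW16 : Wuthrich2014.thm16_halfEigenCharIdeal_dvd_cyclotomicPrime)
    (hWu : Wuthrich2014.charIdeal_dvd_padicLFunctionBranch_component) :
    X3Sharp ↔
      ((∀ (W : WeierstrassCurve ℚ) [W.IsElliptic] [W.IsGloballyMinimal] (p : ℕ) [Fact p.Prime],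
          W.analyticRank = 0 → p ≠ 2 → ClassX3 W p → SubSemistableTwist W p →
          MissingLowerBoundAt W p) ∧
       (∀ (W : WeierstrassCurve ℚ) [W.IsElliptic] [W.IsGloballyMinimal] (p : ℕ) [Fact p.Prime],
          W.analyticRank = 1 → p ≠ 2 → ClassX3 W p → SubSemistableTwist W p →
          MissingPPartAt W p)) ∧
      X3SharpGordHigher ∧ X3SharpTprime ∧ X3SharpW := by
  rw [x3Sharp_iff_twist_split,
    x3SharpSemistableTwist_iff_lower_and_rankOne hDel hGZK hmod hmodD hW16 hWu]

end Summit.BirchSwinnertonDyer.Rank1Residual.Additive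

end
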